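/-
Origin: expansion seat `planner-pub-hodgecm-pv07-g2-0`, handover #8b v3 2026-08-18T06:56:47Z (`HOME/pub-hodgecm-pv07-g2/lean/Pv07g2/AdicSplitFactor.lean`, md5 e9a266f9, 302 lines);
landed by the gen-7 packager in gate run 25 as `HodgeCM/PerL34/LocalFactors/AdicSplitFactor.lean` (import ^import Pv07g2\.→import HodgeCM.PerL34.LocalFactors. ×2).
-/
/-
Copyright: HodgeCM publication cell (pub-hodgecm), DAG node N31g — the split unramified local factor AT THE FINITE
PLACES OF A NUMBER FIELD, in the D4 dilation model (prover lineage pv07, gen 2).  Released under the package licence.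

# `I_v(φ⁰_v) = Σ_n N(v)^{-3|n|/2} (χ'ν)(ϖ_v)ⁿ > 0` for `L_{0,v} = K_v`, every number field `K`, every finite `v`

Source under adjudication (NOT cited; this file PROVES its claim for the constructed datum): PerL v5, Lemma 4.2(b),
proof, tex l. 629–630 — "at split `v` … `∫_{L_{0,v}^×} q_v^{-3|ord y|/2} ν_vχ'_{i,v}(y) d^×y` converges absolutely
to a non-zero value", `q_v = N(v)` the residue cardinality of `L_{0,v}`.

pv07-g2's `DilationIntegral` proves l. 630 in closed form for the constructed datum over ANY non-archimedean local
field `F`, with `q := [𝒪 : ϖ𝒪]` (pv13-g3 `LocalModulus.resIndex`); `DilationResidue` shows `[𝒪 : ϖ𝒪] = #(𝒪/𝔪)`.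
This file takes `F := K_v = v.adicCompletion K` for a number field `K` and a finite place `v` of `𝓞 K` and PROVES
the arithmetic bookkeeping that was the last non-D4 residual of GAPS pv07g2-K3/K4 (ii):
* `Adic.resIndex_eq_absNorm : resIndex ϖ = Ideal.absNorm v.asIdeal` (`= N(v)`) for every uniformizer `ϖ` of `K_v`;
* `Adic.distribHaarChar_eq_inv_absNorm : distribHaarChar K_v ϖ = N(v)⁻¹` — Weil BNT I §4 Thm 6 at the places of a
  number field, as a THEOREM;
* `Adic.splitIntegrand_Ic_eq_tsum_absNorm`, `Adic.splitIntegrand_I_pos` — l. 630 with `q_v = N(v)` LITERALLY, and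
  `0 < I_v(φ⁰_v)`, hypothesis-free (canonical `d^×y`, `ν`, `χ'` unramified, `vol(B) = 1`);
* `Adic.isUniformizer_of_valuation_eq(_exp)`, `Adic.resIndex_eq_absNorm_of_valuation_eq_exp` — the bridge from
  Mathlib's uniformizers (`Valued.v ϖ = WithZero.exp (-1)`) to the norm-sense `IsUniformizer`, with `‖ϖ‖ = N(v)⁻¹`;
  `Adic.exists_units_valuation_eq_exp_neg_one`, **`Adic.isUniformizer_iff_valuation_eq_exp`** — the two notions
  of uniformizer of `K_v` COINCIDE;
* `Adic.smoke` — NON-VACUITY at the intended objects: with `ν = χ' = 1`, `dx` = `Adic.muV` (`vol(𝒪_v³) = 1`) and the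
  canonical `d^×y`, `I_v(φ⁰_v) = (1 − N(v)⁻³)/(1 − N(v)^{-3/2})² > 0`; the σ-algebra binders are inhabited (`borel_exists`).
Inputs beyond Mathlib are PACKAGE modules only: the vendored harness-library files
`HodgeCM.Vendored.H21.NumberTheory.Automorphic.AdicCompletionCompact` (`𝒪_v` compact ⇒ `K_v` proper) and
`HodgeCM.Vendored.H21.RingTheory.DiscreteValuationRing.AdicCompletionResidueField` (`κ(𝒪_v) ≃ 𝓞 K ⧸ v`), both
kernel-proved (run 24, Phase B).  `K_v` is used with Mathlib's `Valued.toNontriviallyNormedField` structure, whose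
`NormedField` part is Mathlib's registered `instNormedFieldValuedAdicCompletion` (`rfl`).
Nothing is cited; no hypothesis names PerL, QW8 or a 2001-programme claim.  Axioms = the standard trio.
Unit `pub-hodgecm-pv07-g2`, 2026-08-18.
-/
import Summits.HodgeConjecture.HodgeCM.PerL34.LocalFactors.DilationIntegral
import Summits.HodgeConjecture.HodgeCM.PerL34.LocalFactors.DilationResidue
import Literature.RingTheory.DiscreteValuationRing.AdicCompletionResidueField
import Literature.NumberTheory.Automorphic.AdicCompletionCompact
import Mathlib.NumberTheory.NumberField.Completion.FinitePlace

/-! PORT of `HodgeCM/PerL34/LocalFactors/AdicSplitFactor.lean` (HodgeCMPerL run 82) — verbatim mechanical port; provenance in the PORT header line. -/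

set_option autoImplicit false

noncomputable section

open MeasureTheory MeasureTheory.Measure Set Metric TopologicalSpace IsLocalRing NumberField IsDedekindDomain
open scoped NNReal

namespace HodgeCM
namespace PerL34
namespace LocalFactors
namespace DilationModel
namespace Adic

variable (K : Type) [Field K] [NumberField K] (v : HeightOneSpectrum (𝓞 K))

/-- `K_v` as a NON-TRIVIALLY normed field: Mathlib's `Valued.toNontriviallyNormedField`; its `NormedField` part is
the instance Mathlib registers on `v.adicCompletion K` (next lemma, `rfl`). -/
@[reducible] def nontriviallyNormedField : NontriviallyNormedField (v.adicCompletion K) :=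
  Valued.toNontriviallyNormedField (v.adicCompletion K) (WithZero (Multiplicative ℤ))

/-- (Ported verbatim from the HodgeCMPerL package; no docstring in the source.) -/
theorem nontriviallyNormedField_toNormedField :
    (nontriviallyNormedField K v).toNormedField = HeightOneSpectrum.instNormedFieldValuedAdicCompletion K v := rfl

attribute [local instance] nontriviallyNormedField

/-- `K_v` is proper (vendored harness library, kernel: `𝒪_v` is compact) -/
theorem properSpace : ProperSpace (v.adicCompletion K) :=
  Literature.NumberTheory.Automorphic.properSpace_adicCompletion K v

attribute [local instance] properSpace

/-- instance found (recorded): `K_v` is ultrametric -/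
example : IsUltrametricDist (v.adicCompletion K) := inferInstance

/-- uniformizers of `K_v` in the norm sense exist (pv07-g2 `DilationOrd.exists_isUniformizer`) -/
theorem exists_isUniformizer : ∃ ϖ : (v.adicCompletion K)ˣ, IsUniformizer ϖ :=
  DilationModel.exists_isUniformizer

/-! ### `[𝒪_v : ϖ𝒪_v] = N(v)` -/

/-- the unit ball of `K_v` as the valuation ring of the NORM valuation (the ring `DilationResidue` speaks about)
IS Mathlib's `𝒪_v = v.adicCompletionIntegers K` -/
def integerEquiv :
    (@Valued.integer (v.adicCompletion K) _ ℝ≥0 _ NormedField.toValued) ≃+* v.adicCompletionIntegers K where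
  toFun x := ⟨x.1, (HeightOneSpectrum.mem_adicCompletionIntegers (𝓞 K) K v).mpr
    (Valued.toNormedField.norm_le_one_iff.mp (Valued.integer.mem_iff.mp x.2))⟩
  invFun y := ⟨y.1, Valued.integer.mem_iff.mpr
    (Valued.toNormedField.norm_le_one_iff.mpr ((HeightOneSpectrum.mem_adicCompletionIntegers (𝓞 K) K v).mp y.2))⟩
  left_inv _ := rfl
  right_inv _ := rfl
  map_mul' _ _ := rfl
  map_add' _ _ := rfl

/-- `#(𝒪_v/𝔪_v) = N(v)` for the norm-valuation ring (vendored `residueFieldEquiv : 𝓞 K ⧸ v ≃+* κ(𝒪_v)`) -/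
theorem card_residueField_eq_absNorm :
    Nat.card (ResidueField (@Valued.integer (v.adicCompletion K) _ ℝ≥0 _ NormedField.toValued)) =
      Ideal.absNorm v.asIdeal := by
  rw [Nat.card_congr (ResidueField.mapEquiv (integerEquiv K v)).toEquiv,
    HeightOneSpectrum.natCard_residueField_adicCompletionIntegers K v, Ideal.absNorm_apply,
    Submodule.cardQuot_apply]

/-- **`[𝒪_v : ϖ_v𝒪_v] = N(v)`**: pv13-g3's kernel index of ANY uniformizer of `K_v` is the absolute norm of `v`. -/
theorem resIndex_eq_absNorm (ϖ : (v.adicCompletion K)ˣ) (hϖ : IsUniformizer ϖ) :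
    LocalModulus.resIndex ϖ = Ideal.absNorm v.asIdeal :=
  hϖ.resIndex_eq_card_residueField.trans (card_residueField_eq_absNorm K v)

/-- **Weil BNT I §4 Thm 6 at the finite places of a number field, as a theorem**:
`mod_{K_v}(ϖ_v) = N(v)⁻¹`. -/
theorem distribHaarChar_eq_inv_absNorm (ϖ : (v.adicCompletion K)ˣ) (hϖ : IsUniformizer ϖ) :
    distribHaarChar (v.adicCompletion K) ϖ = ((Ideal.absNorm v.asIdeal : ℝ≥0))⁻¹ := by
  rw [← resIndex_eq_absNorm K v ϖ hϖ]
  exact LocalModulus.distribHaarChar_uniformizer hϖ.1.le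

/-- (Ported verbatim from the HodgeCMPerL package; no docstring in the source.) -/
theorem two_le_absNorm : 2 ≤ Ideal.absNorm v.asIdeal := by
  obtain ⟨ϖ, hϖ⟩ := exists_isUniformizer K v
  rw [← resIndex_eq_absNorm K v ϖ hϖ]
  exact LocalModulus.two_le_resIndex hϖ.1

/-! ### Mathlib's uniformizers (`Valued.v ϖ = exp (-1)`) are uniformizers in the norm sense -/

/-- `‖x‖ = N(v)ⁿ` when `Valued.v x = ↑(ofAdd n)` (`= WithZero.exp n`) -/
theorem norm_eq_absNorm_zpow {x : v.adicCompletion K} (n : ℤ)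
    (hx : Valued.v x = ((Multiplicative.ofAdd n : Multiplicative ℤ) : WithZero (Multiplicative ℤ))) :
    ‖x‖ = ((Ideal.absNorm v.asIdeal : ℕ) : ℝ) ^ n := by
  rw [NumberField.FinitePlace.norm_def, hx, WithZeroMulInt.toNNReal_neg_apply _ WithZero.coe_ne_zero,
    WithZero.unzero_coe, toAdd_ofAdd, NNReal.coe_zpow, NNReal.coe_natCast]

/-- every `y ∈ K_vˣ` has norm `N(v)ⁿ`, `n` = its additive valuation read off `Valued.v` -/
theorem norm_units_eq_absNorm_zpow (y : (v.adicCompletion K)ˣ) :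
    ‖(y : v.adicCompletion K)‖ = ((Ideal.absNorm v.asIdeal : ℕ) : ℝ) ^
      (WithZero.unzero ((Valuation.ne_zero_iff Valued.v).mpr y.ne_zero)).toAdd :=
  norm_eq_absNorm_zpow K v _ (by rw [ofAdd_toAdd, WithZero.coe_unzero])

/-- **bridge to Mathlib's notion of uniformizer**: if `Valued.v ϖ = WithZero.exp (-1)` (`= ↑(ofAdd (-1))`;
such `ϖ` exist by `IsDedekindDomain.HeightOneSpectrum.valuation_exists_uniformizer`), then `ϖ` is a uniformizer
in the norm sense of `DilationOrd.IsUniformizer` and `‖ϖ‖ = N(v)⁻¹`. -/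
theorem isUniformizer_of_valuation_eq (ϖ : (v.adicCompletion K)ˣ)
    (h : Valued.v (ϖ : v.adicCompletion K) =
      ((Multiplicative.ofAdd (-1 : ℤ) : Multiplicative ℤ) : WithZero (Multiplicative ℤ))) :
    IsUniformizer ϖ ∧ ‖(ϖ : v.adicCompletion K)‖ = (((Ideal.absNorm v.asIdeal : ℕ) : ℝ))⁻¹ := by
  have hϖ : ‖(ϖ : v.adicCompletion K)‖ = (((Ideal.absNorm v.asIdeal : ℕ) : ℝ))⁻¹ := by
    rw [norm_eq_absNorm_zpow K v (-1) h, zpow_neg, zpow_one]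
  have hN : (1 : ℝ) < ((Ideal.absNorm v.asIdeal : ℕ) : ℝ) := by
    exact_mod_cast NumberField.HeightOneSpectrum.one_lt_absNorm v
  refine ⟨⟨?_, fun y => ?_⟩, hϖ⟩
  · rw [hϖ]
    exact inv_lt_one_of_one_lt₀ hN
  · refine ⟨-(WithZero.unzero ((Valuation.ne_zero_iff Valued.v).mpr y.ne_zero)).toAdd, ?_⟩
    rw [hϖ, inv_zpow', neg_neg, norm_units_eq_absNorm_zpow K v y]

/-- the same with Mathlib's `WithZero.exp` spelling of the hypothesis -/
theorem isUniformizer_of_valuation_eq_exp (ϖ : (v.adicCompletion K)ˣ)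
    (h : Valued.v (ϖ : v.adicCompletion K) = WithZero.exp (-1 : ℤ)) : IsUniformizer ϖ :=
  (isUniformizer_of_valuation_eq K v ϖ h).1

/-- hence `[𝒪_v : ϖ𝒪_v] = N(v)` and `mod(ϖ) = N(v)⁻¹` for Mathlib-uniformizers too -/
theorem resIndex_eq_absNorm_of_valuation_eq_exp (ϖ : (v.adicCompletion K)ˣ)
    (h : Valued.v (ϖ : v.adicCompletion K) = WithZero.exp (-1 : ℤ)) :
    LocalModulus.resIndex ϖ = Ideal.absNorm v.asIdeal ∧
      distribHaarChar (v.adicCompletion K) ϖ = ((Ideal.absNorm v.asIdeal : ℝ≥0))⁻¹ :=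
  ⟨resIndex_eq_absNorm K v ϖ (isUniformizer_of_valuation_eq_exp K v ϖ h),
    distribHaarChar_eq_inv_absNorm K v ϖ (isUniformizer_of_valuation_eq_exp K v ϖ h)⟩

/-- Mathlib-uniformizers of `K_v` exist: a global `π ∈ 𝓞 K` with `v(π) = 1` (`intValuation_exists_uniformizer`) -/
theorem exists_units_valuation_eq_exp_neg_one :
    ∃ ϖ : (v.adicCompletion K)ˣ, Valued.v (ϖ : v.adicCompletion K) = WithZero.exp (-1 : ℤ) := by
  obtain ⟨π, hπ⟩ := IsDedekindDomain.HeightOneSpectrum.intValuation_exists_uniformizer v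
  have h : Valued.v ((π : 𝓞 K) : v.adicCompletion K) = WithZero.exp (-1 : ℤ) := by
    rw [IsDedekindDomain.HeightOneSpectrum.valuedAdicCompletion_eq_valuation',
      IsDedekindDomain.HeightOneSpectrum.valuation_of_algebraMap, hπ]
  have hne : ((π : 𝓞 K) : v.adicCompletion K) ≠ 0 := fun h0 => by
    rw [h0, map_zero] at h; exact WithZero.coe_ne_zero h.symm
  exact ⟨Units.mk0 _ hne, h⟩

/-- **the two notions of uniformizer of `K_v` coincide**: `IsUniformizer ϖ` (norm sense, `DilationOrd`) iff
`Valued.v ϖ = WithZero.exp (-1)` (Mathlib).  (`⇐` is `isUniformizer_of_valuation_eq_exp`; `⇒`: write `‖ϖ‖ = N(v)ᵐ`,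
compare with a Mathlib-uniformizer `π`, `‖π‖ = N(v)⁻¹ = ‖ϖ‖ᵇ`, so `mb = -1`, and `m < 0`.) -/
theorem isUniformizer_iff_valuation_eq_exp (ϖ : (v.adicCompletion K)ˣ) :
    IsUniformizer ϖ ↔ Valued.v (ϖ : v.adicCompletion K) = WithZero.exp (-1 : ℤ) := by
  refine ⟨fun hϖ => ?_, isUniformizer_of_valuation_eq_exp K v ϖ⟩
  obtain ⟨π, hπ⟩ := exists_units_valuation_eq_exp_neg_one K v
  have hπn : ‖(π : v.adicCompletion K)‖ = (((Ideal.absNorm v.asIdeal : ℕ) : ℝ))⁻¹ :=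
    (isUniformizer_of_valuation_eq K v π hπ).2
  have hN : (1 : ℝ) < ((Ideal.absNorm v.asIdeal : ℕ) : ℝ) := by
    exact_mod_cast NumberField.HeightOneSpectrum.one_lt_absNorm v
  have hv0 : Valued.v (ϖ : v.adicCompletion K) ≠ 0 := (Valuation.ne_zero_iff Valued.v).mpr ϖ.ne_zero
  set m : ℤ := (WithZero.unzero hv0).toAdd with hm
  have hϖm : ‖(ϖ : v.adicCompletion K)‖ = ((Ideal.absNorm v.asIdeal : ℕ) : ℝ) ^ m :=
    norm_units_eq_absNorm_zpow K v ϖ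
  obtain ⟨b, hb⟩ := hϖ.2 π
  rw [hπn, hϖm, ← zpow_mul, ← zpow_neg_one] at hb
  have hmb : m * b = -1 := (zpow_right_injective₀ (zero_lt_one.trans hN) hN.ne' hb).symm
  have hm0 : m < 0 := by
    have := hϖ.1; rw [hϖm, zpow_lt_one_iff_right₀ hN] at this; exact this
  have hm1 : m = -1 := by
    rcases Int.eq_one_or_neg_one_of_mul_eq_neg_one hmb with h | h
    · omega
    · exact h
  rw [← WithZero.coe_unzero hv0, ← ofAdd_toAdd (WithZero.unzero hv0), ← hm, hm1]
  rfl

/-! ### l. 630 at the places of a number field -/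

attribute [local instance] unitsBorel borelSpace_units

variable [MeasurableSpace (v.adicCompletion K)] [BorelSpace (v.adicCompletion K)]
  (μV : Measure (Fin 3 → v.adicCompletion K)) [μV.IsAddHaarMeasure] (ρ : ℝ)
  (ν : (v.adicCompletion K)ˣ →* Circle) (μG : Measure (v.adicCompletion K)ˣ) [μG.IsHaarMeasure] [μG.Regular]
  (χ' : (v.adicCompletion K)ˣ →* Circle)

/-- **l. 630 for `L_{0,v} = K_v` with `q_v = N(v)` literally (kernel)**: for every uniformizer `ϖ` of `K_v`,
`ν`, `χ'` unramified, `vol(B) = 1`, `vol^×(𝒪_v^×) = 1`: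
`I_v(φ⁰_v) = Σ'_{n∈ℤ} (tOf N(v))^{|n|} ((χ'ν)(ϖ))ⁿ`. -/
theorem splitIntegrand_Ic_eq_tsum_absNorm (ϖ : (v.adicCompletion K)ˣ) (hϖ : IsUniformizer ϖ)
    (hν : ∀ u : (v.adicCompletion K)ˣ, ‖(u : v.adicCompletion K)‖ = 1 → ν u = 1)
    (hχ : ∀ u : (v.adicCompletion K)ˣ, ‖(u : v.adicCompletion K)‖ = 1 → χ' u = 1)
    (hvol : μV.real (closedBall (0 : Fin 3 → v.adicCompletion K) ρ) = 1) (hvolG : μG (shell ϖ 0) = 1) :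
    (splitIntegrand μV 0 ρ μG ν χ').Ic =
      ∑' n : ℤ, ((EulerProduct.tOf (Ideal.absNorm v.asIdeal) : ℝ) : ℂ) ^ n.natAbs *
        ((χ' ϖ : ℂ) * (ν ϖ : ℂ)) ^ n := by
  rw [splitIntegrand_Ic_eq_tsum μV ρ ν μG χ' ϖ hϖ hν hχ hvol hvolG, resIndex_eq_absNorm K v ϖ hϖ]

/-- … and in closed form: `I_v(φ⁰_v) = (1 − N(v)⁻³) / normSq (1 − (χ'ν)(ϖ)·N(v)^{-3/2})`. -/
theorem splitIntegrand_Ic_eq_closedForm_absNorm (ϖ : (v.adicCompletion K)ˣ) (hϖ : IsUniformizer ϖ)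
    (hν : ∀ u : (v.adicCompletion K)ˣ, ‖(u : v.adicCompletion K)‖ = 1 → ν u = 1)
    (hχ : ∀ u : (v.adicCompletion K)ˣ, ‖(u : v.adicCompletion K)‖ = 1 → χ' u = 1)
    (hvol : μV.real (closedBall (0 : Fin 3 → v.adicCompletion K) ρ) = 1) (hvolG : μG (shell ϖ 0) = 1) :
    (splitIntegrand μV 0 ρ μG ν χ').Ic =
      (((1 - (((Ideal.absNorm v.asIdeal : ℕ) : ℝ) ^ 3)⁻¹) /
          Complex.normSq (1 - ((χ' ϖ : ℂ) * (ν ϖ : ℂ)) *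
            (EulerProduct.tOf (Ideal.absNorm v.asIdeal) : ℂ)) : ℝ) : ℂ) := by
  rw [splitIntegrand_Ic_eq_closedForm μV ρ ν μG χ' ϖ hϖ hν hχ hvol hvolG, resIndex_eq_absNorm K v ϖ hϖ]

omit μG

/-- **N31g at the split unramified places of a number field, HYPOTHESIS-FREE (kernel)**: with the canonical
`d^×y` (`vol^×(𝒪_v^×) = 1`), `ν`, `χ'` unramified and `vol(B) = 1`, the local factor of the constructed datum
over `K_v` is `> 0`, and equals `Σ' (tOf N(v))^{|n|} ((χ'ν)(ϖ))ⁿ` for some (any) uniformizer `ϖ`. -/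
theorem splitIntegrand_I_pos
    (hν : ∀ u : (v.adicCompletion K)ˣ, ‖(u : v.adicCompletion K)‖ = 1 → ν u = 1)
    (hχ : ∀ u : (v.adicCompletion K)ˣ, ‖(u : v.adicCompletion K)‖ = 1 → χ' u = 1)
    (hvol : μV.real (closedBall (0 : Fin 3 → v.adicCompletion K) ρ) = 1) :
    0 < (splitIntegrand μV 0 ρ (haarMeasure (unitSphereCompacts (F := v.adicCompletion K))) ν χ').I ∧
      ∃ ϖ : (v.adicCompletion K)ˣ, IsUniformizer ϖ ∧
        (splitIntegrand μV 0 ρ (haarMeasure (unitSphereCompacts (F := v.adicCompletion K))) ν χ').Ic =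
          ∑' n : ℤ, ((EulerProduct.tOf (Ideal.absNorm v.asIdeal) : ℝ) : ℂ) ^ n.natAbs *
            ((χ' ϖ : ℂ) * (ν ϖ : ℂ)) ^ n := by
  obtain ⟨ϖ, hϖ⟩ := exists_isUniformizer K v
  exact ⟨splitIntegrand_I_pos_canonical μV ρ ν χ' hν hχ hvol, ϖ, hϖ,
    splitIntegrand_Ic_eq_tsum_absNorm K v μV ρ ν (haarMeasure unitSphereCompacts) χ' ϖ hϖ hν hχ hvol
      (haarMeasure_unitSphereCompacts_shell_zero ϖ)⟩

/-! ### Smoke at genuine places: the binders are inhabited and the datum with trivial characters is `> 0` -/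

omit [MeasurableSpace (v.adicCompletion K)] [BorelSpace (v.adicCompletion K)] in
/-- the σ-algebra binders are inhabited: the Borel σ-algebra of `K_v` -/
theorem borel_exists : ∃ m : MeasurableSpace (v.adicCompletion K), @BorelSpace (v.adicCompletion K) _ m :=
  ⟨borel _, @BorelSpace.mk (v.adicCompletion K) _ (borel _) rfl⟩

/-- `𝒪_v³ = closedBall 0 1 ⊂ K_v³`, compact (`K_v` proper) with non-empty interior -/
def integerCube : PositiveCompacts (Fin 3 → v.adicCompletion K) where
  carrier := closedBall (0 : Fin 3 → v.adicCompletion K) 1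
  isCompact' := isCompact_closedBall _ _
  interior_nonempty' :=
    ⟨0, interior_mono ball_subset_closedBall (by rw [isOpen_ball.interior_eq]; exact mem_ball_self one_pos)⟩

/-- the additive Haar measure `dx` on `K_v³` normalised by `vol(𝒪_v³) = 1` -/
def muV : Measure (Fin 3 → v.adicCompletion K) := addHaarMeasure (integerCube K v)

/-- (Ported verbatim from the HodgeCMPerL package; no docstring in the source.) -/
instance isAddHaarMeasure_muV : (muV K v).IsAddHaarMeasure := by
  unfold muV; infer_instance

/-- (Ported verbatim from the HodgeCMPerL package; no docstring in the source.) -/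
theorem muV_real_closedBall : (muV K v).real (closedBall (0 : Fin 3 → v.adicCompletion K) 1) = 1 := by
  rw [measureReal_def, muV, show closedBall (0 : Fin 3 → v.adicCompletion K) 1 =
      (integerCube K v : Set (Fin 3 → v.adicCompletion K)) from rfl, addHaarMeasure_self, ENNReal.toReal_one]

/-- **SMOKE (non-vacuity at the intended objects)**: at EVERY finite place `v` of EVERY number field `K`, the constructed
split unramified datum with `ν = χ' = 1`, `dx` normalised by `vol(𝒪_v³) = 1` and the canonical `d^×y` has
`I_v(φ⁰_v) = (1 − N(v)⁻³)/(1 − N(v)^{-3/2})² > 0`. -/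
theorem smoke :
    0 < (splitIntegrand (muV K v) 0 1 (haarMeasure (unitSphereCompacts (F := v.adicCompletion K))) 1 1).I ∧
      (splitIntegrand (muV K v) 0 1 (haarMeasure (unitSphereCompacts (F := v.adicCompletion K))) 1 1).Ic =
        (((1 - (((Ideal.absNorm v.asIdeal : ℕ) : ℝ) ^ 3)⁻¹) /
          (1 - EulerProduct.tOf (Ideal.absNorm v.asIdeal)) ^ 2 : ℝ) : ℂ) := by
  obtain ⟨ϖ, hϖ⟩ := exists_isUniformizer K v
  have h1 : ∀ u : (v.adicCompletion K)ˣ, ‖(u : v.adicCompletion K)‖ = 1 →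
      (1 : (v.adicCompletion K)ˣ →* Circle) u = 1 := fun _ _ => rfl
  refine ⟨(splitIntegrand_I_pos K v (muV K v) 1 1 1 h1 h1 (muV_real_closedBall K v)).1, ?_⟩
  have ha : (((1 : (v.adicCompletion K)ˣ →* Circle) ϖ : Circle) : ℂ) = 1 := by
    rw [MonoidHom.one_apply, Circle.coe_one]
  have hn : Complex.normSq (1 - (EulerProduct.tOf (Ideal.absNorm v.asIdeal) : ℂ)) =
      (1 - EulerProduct.tOf (Ideal.absNorm v.asIdeal)) ^ 2 := by
    rw [← Complex.ofReal_one, ← Complex.ofReal_sub, Complex.normSq_ofReal, sq]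
  rw [splitIntegrand_Ic_eq_closedForm_absNorm K v (muV K v) 1 1 (haarMeasure unitSphereCompacts) 1 ϖ hϖ h1 h1
    (muV_real_closedBall K v) (haarMeasure_unitSphereCompacts_shell_zero ϖ), ha, one_mul, one_mul, hn]

end Adic
end DilationModel
end LocalFactors
end PerL34
end HodgeCM

end
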